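import Mathlib
import Literature.NumberTheory.Sieve.IntervalResidueClassSieve
import HarnessLib

/-!
# Route ParityLeakOneFifth, crux `PlainSplit` (item stmt-Parity-18382), line `birth`:
# stub `stub_roughMass` — the model mass `B = Σ_{x<n≤2x} b_n = (1 + o(1))·x`

The `z`-rough model of the route is `b_n = 1[P⁻(n) ≥ z]/V(z)` with `z = exp((log log x)²)` and
`V(z) = ∏_{p<z} (1 − 1/p)`.  This file proves the registered stub `stub_roughMass` of the BC3 skeleton
`Summits/Parity/GeneralizedHardyLittlewood/Cruxes/PlainSplit/Lines/birth.lean` verbatim: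

  for every `δ > 0`, eventually in `x : ℕ`, `|Σ_{x<n≤2x} b_n − x| ≤ δ x`,

i.e. the `z`-rough integers of `(x, 2x]` number `(1 + o(1))·x·V(z)`.  The proof is the fundamental
lemma of sieve theory for an interval sifted by one residue class per prime, in the tree's proved form
`Literature.NumberTheory.Sieve.IntervalClassSieve.abs_card_sub_le` (Halberstam–Richert Thm 2.5;
Friedlander–Iwaniec, *Opera de Cribro*, Cor. 6.10): the window `(x, 2x]` is the shifted interval
`n = x + r`, `1 ≤ r ≤ x`, and `p ∣ n` is the residue class `r ≡ −x (mod p)`; at level `L = z^s`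
the error is `C x V e^{−s} + z^{2s}`, and `z^{2s} = exp(2s (log log x)²) = x^{o(1)}` is absorbed using
`V(z) ≥ c/(log z)²` (`IntervalClassSieve.le_prod_one_sub_card_div`).

Contents: growth lemmas for the parameter `t = log log x` (`exists_quadratic_le_exp`,
`exists_pow_four_le_mul_exp`, `exists_nat_loglog_ge`), the dictionary between the window `(x, 2x]`
and the shifted interval (`dvd_add_iff_mod_eq`, `card_rough_Ioc_eq`), and `stub_roughMass`.
-/

namespace Summit.Parity.GeneralizedHardyLittlewood.Theorems.ParityLeakOneFifth

open Finset Real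

/-! ### Growth lemmas for the route's parameter `t = log log x` -/

/-- For all real `a, b, c` there is `T ≥ 1` with `a t² + b t + c ≤ e^t` for all `t ≥ T`
(from `t³/3! ≤ e^t`). -/
theorem exists_quadratic_le_exp (a b c : ℝ) :
    ∃ T : ℝ, 1 ≤ T ∧ ∀ t : ℝ, T ≤ t → a * t ^ 2 + b * t + c ≤ Real.exp t := by
  refine ⟨max 1 (6 * (|a| + |b| + |c|)), le_max_left _ _, fun t ht => ?_⟩
  have ht1 : 1 ≤ t := le_trans (le_max_left _ _) ht
  have ht6 : 6 * (|a| + |b| + |c|) ≤ t := le_trans (le_max_right _ _) ht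
  have ht0 : 0 ≤ t := by linarith
  have htt : t ≤ t ^ 2 := by nlinarith
  have h1t : (1 : ℝ) ≤ t ^ 2 := by nlinarith
  have h1 : a * t ^ 2 + b * t + c ≤ (|a| + |b| + |c|) * t ^ 2 := by
    have ha : a * t ^ 2 ≤ |a| * t ^ 2 := mul_le_mul_of_nonneg_right (le_abs_self a) (by positivity)
    have hb : b * t ≤ |b| * t ^ 2 :=
      (mul_le_mul_of_nonneg_right (le_abs_self b) ht0).trans
        (mul_le_mul_of_nonneg_left htt (abs_nonneg b))
    have hc : c ≤ |c| * t ^ 2 := by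
      calc c ≤ |c| := le_abs_self c
        _ = |c| * 1 := (mul_one _).symm
        _ ≤ |c| * t ^ 2 := mul_le_mul_of_nonneg_left h1t (abs_nonneg c)
    linarith
  have h2 : t ^ 3 / 6 ≤ Real.exp t := by
    have h := Real.pow_div_factorial_le_exp t ht0 3
    norm_num [Nat.factorial] at h
    exact h
  have h3 : (|a| + |b| + |c|) * t ^ 2 ≤ t ^ 3 / 6 := by
    have h := mul_le_mul_of_nonneg_right ht6 (sq_nonneg t)
    have e : t * t ^ 2 = t ^ 3 := by ring
    rw [e] at h
    linarith
  linarith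

/-- For `κ > 0` there is `T ≥ 1` with `t⁴ ≤ κ e^t` for all `t ≥ T` (from `t⁵/5! ≤ e^t`). -/
theorem exists_pow_four_le_mul_exp {κ : ℝ} (hκ : 0 < κ) :
    ∃ T : ℝ, 1 ≤ T ∧ ∀ t : ℝ, T ≤ t → t ^ 4 ≤ κ * Real.exp t := by
  refine ⟨max 1 (120 / κ), le_max_left _ _, fun t ht => ?_⟩
  have ht1 : 1 ≤ t := le_trans (le_max_left _ _) ht
  have htκ : 120 / κ ≤ t := le_trans (le_max_right _ _) ht
  have ht0 : 0 ≤ t := by linarith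
  have h120 : 120 ≤ κ * t := by
    have := (div_le_iff₀ hκ).1 htκ
    linarith
  have h2 : t ^ 5 / 120 ≤ Real.exp t := by
    have h := Real.pow_div_factorial_le_exp t ht0 5
    norm_num [Nat.factorial] at h
    exact h
  have h3 : t ^ 4 ≤ κ * (t ^ 5 / 120) := by
    have h4 : (0 : ℝ) ≤ t ^ 4 := by positivity
    have := mul_le_mul_of_nonneg_right h120 h4
    nlinarith
  calc t ^ 4 ≤ κ * (t ^ 5 / 120) := h3
    _ ≤ κ * Real.exp t := mul_le_mul_of_nonneg_left h2 hκ.le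

/-- For every real `T` there is `x₀ : ℕ` such that for all naturals `x ≥ x₀`:
`exp(exp T) ≤ x`, `exp T ≤ log x` and `T ≤ log log x`. -/
theorem exists_nat_loglog_ge (T : ℝ) :
    ∃ x₀ : ℕ, ∀ x : ℕ, x₀ ≤ x → Real.exp (Real.exp T) ≤ (x : ℝ) ∧
      Real.exp T ≤ Real.log (x : ℝ) ∧ T ≤ Real.log (Real.log (x : ℝ)) := by
  refine ⟨⌈Real.exp (Real.exp T)⌉₊, fun x hx => ?_⟩
  have hE : 0 < Real.exp (Real.exp T) := Real.exp_pos _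
  have hxE : Real.exp (Real.exp T) ≤ (x : ℝ) := (Nat.le_ceil _).trans (by exact_mod_cast hx)
  have hx0 : (0 : ℝ) < x := hE.trans_le hxE
  have h1 : Real.exp T ≤ Real.log (x : ℝ) := by
    rw [Real.le_log_iff_exp_le hx0]; exact hxE
  have h2 : 0 < Real.log (x : ℝ) := (Real.exp_pos T).trans_le h1
  refine ⟨hxE, h1, ?_⟩
  rw [Real.le_log_iff_exp_le h2]
  exact h1

/-! ### The window `(x, 2x]` as a shifted interval -/

/-- For `p > 0`: `p ∣ x + r` iff `r` lies in the residue class `−x (mod p)`, written with natural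
number remainders as `r % p = (p − x % p) % p`. -/
theorem dvd_add_iff_mod_eq {p : ℕ} (hp : 0 < p) (x r : ℕ) :
    p ∣ x + r ↔ r % p = (p - x % p) % p := by
  haveI : NeZero p := ⟨hp.ne'⟩
  rw [← ZMod.natCast_eq_natCast_iff', ← ZMod.natCast_eq_zero_iff]
  have h : ((p - x % p : ℕ) : ZMod p) = -(x : ZMod p) := by
    rw [Nat.cast_sub (Nat.mod_lt x hp).le, ZMod.natCast_self, ZMod.natCast_mod, zero_sub]
  rw [h, Nat.cast_add, eq_neg_iff_add_eq_zero, add_comm]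

/-- The `z`-rough integers of `(x, 2x]` are counted by the interval residue-class sieve: with
`n = x + r`, `1 ≤ r ≤ x`, the condition "no prime `p < z` divides `n`" reads
"`r % p ≠ (p − x % p) % p` for every prime `p < z`". -/
theorem card_rough_Ioc_eq (x : ℕ) (z : ℝ) :
    #((Ioc x (2 * x)).filter (fun n : ℕ => ∀ p ∈ n.primeFactors, z ≤ (p : ℝ))) =
      #((Icc 1 x).filter (fun r : ℕ => ∀ p ∈ Nat.primesBelow ⌈z⌉₊,
          r % p ∉ ({(p - x % p) % p} : Finset ℕ))) := by
  have hI : Ioc x (2 * x) = (Icc 1 x).map (addLeftEmbedding x) := by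
    rw [← zero_add 1, Finset.Icc_add_one_left_eq_Ioc, Finset.map_add_left_Ioc, add_zero, two_mul]
  rw [hI, Finset.filter_map, Finset.card_map]
  congr 1
  apply Finset.filter_congr
  intro r hr
  have hr1 : 1 ≤ r := (Finset.mem_Icc.1 hr).1
  simp only [Function.comp_apply, addLeftEmbedding_apply, Finset.mem_singleton]
  constructor
  · intro h p hp
    rw [Nat.mem_primesBelow] at hp
    rw [← dvd_add_iff_mod_eq hp.2.pos]
    intro hdvd
    have hzp := h p (Nat.mem_primeFactors.2 ⟨hp.2, hdvd, by omega⟩)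
    exact absurd (Nat.lt_ceil.1 hp.1) (not_lt.2 hzp)
  · intro h p hp
    obtain ⟨hpr, hdvd, -⟩ := Nat.mem_primeFactors.1 hp
    by_contra hlt
    rw [not_le] at hlt
    have h' := h p (Nat.mem_primesBelow.2 ⟨Nat.lt_ceil.2 hlt, hpr⟩)
    rw [← dvd_add_iff_mod_eq hpr.pos] at h'
    exact h' hdvd

/-! ### The stub -/

/-- **Stub `stub_roughMass` of the BC3 skeleton `Cruxes/PlainSplit/Lines/birth.lean`** (registered
signature, verbatim): the model mass `B(x) = Σ_{x<n≤2x} b_n` of the `z`-rough model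
`b_n = 1[P⁻(n) ≥ z]/V(z)`, `z = exp((log log x)²)`, `V(z) = ∏_{p<z}(1 − 1/p)`, satisfies
`|B(x) − x| ≤ δ x` for every `δ > 0` and all large `x`.  Proof: the fundamental lemma for the
shifted interval (`IntervalClassSieve.abs_card_sub_le` with one class per prime) at level `z^s`,
`C e^{−s} ≤ δ/2`, and `z^{2s} (log z)² = exp(2s t²) t⁴ ≤ (δ c/2)·x` for `t = log log x` large
(`V(z) ≥ c/(log z)²`). -/
theorem stub_roughMass : ∀ δ : ℝ, 0 < δ → ∃ x₀ : ℕ, ∀ x : ℕ, x₀ ≤ x → ∀ (z V : ℝ) (b : ℕ → ℝ), z = Real.exp (Real.log (Real.log (x : ℝ)) ^ 2) → V = ∏ p ∈ (Finset.range ⌈z⌉₊).filter Nat.Prime, (1 - 1 / (p : ℝ)) → b = (fun n : ℕ => if ∀ p ∈ n.primeFactors, z ≤ (p : ℝ) then 1 / V else 0) → |(∑ n ∈ Finset.Ioc x (2 * x), b n) - (x : ℝ)| ≤ δ * (x : ℝ) := by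
  intro δ hδ
  obtain ⟨C, hC, hFL⟩ := Literature.NumberTheory.Sieve.IntervalClassSieve.abs_card_sub_le 1
  obtain ⟨c, hc, hVlow⟩ := Literature.NumberTheory.Sieve.IntervalClassSieve.le_prod_one_sub_card_div 1
  -- the sieve parameter `s ≥ 1` with `C e^{-s} ≤ δ/2`
  obtain ⟨s, hs1, hsC⟩ : ∃ s : ℝ, 1 ≤ s ∧ C * Real.exp (-s) ≤ δ / 2 := by
    refine ⟨max 1 (Real.log (2 * C / δ)), le_max_left _ _, ?_⟩
    have h1 : Real.exp (-max 1 (Real.log (2 * C / δ))) ≤ Real.exp (-Real.log (2 * C / δ)) :=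
      Real.exp_le_exp.2 (neg_le_neg (le_max_right _ _))
    rw [Real.exp_neg (Real.log _), Real.exp_log (by positivity)] at h1
    calc C * Real.exp (-max 1 (Real.log (2 * C / δ)))
        ≤ C * (2 * C / δ)⁻¹ := mul_le_mul_of_nonneg_left h1 hC.le
      _ = δ / 2 := by field_simp
  -- growth in `t = log log x`
  obtain ⟨T, hT1, hT⟩ := exists_quadratic_le_exp (2 * s) 4 (-Real.log (δ * c / 2))
  obtain ⟨x₀, hx₀⟩ := exists_nat_loglog_ge T
  refine ⟨x₀, fun x hx => ?_⟩
  rintro z V b rfl rfl rfl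
  obtain ⟨hxE, hlogx, hTt⟩ := hx₀ x hx
  set t : ℝ := Real.log (Real.log (x : ℝ)) with ht
  have ht1 : 1 ≤ t := hT1.trans hTt
  have ht0 : 0 ≤ t := by linarith
  have hx0 : (0 : ℝ) < x := (Real.exp_pos _).trans_le hxE
  have hlogpos : 0 < Real.log (x : ℝ) := (Real.exp_pos _).trans_le hlogx
  have hexpt : Real.exp t = Real.log (x : ℝ) := by rw [ht, Real.exp_log hlogpos]
  have hxexp : Real.exp (Real.exp t) = (x : ℝ) := by rw [hexpt, Real.exp_log hx0]
  -- the parameters `z = exp(t²)` and `L = z^s`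
  set z : ℝ := Real.exp (t ^ 2) with hz
  have hz0 : 0 < z := Real.exp_pos _
  have hz2 : 2 ≤ z := by
    have h1 : Real.exp 1 ≤ z := Real.exp_le_exp.2 (by nlinarith)
    have h2 : (2 : ℝ) ≤ Real.exp 1 := by
      have := Real.exp_one_gt_d9; linarith
    linarith
  have hz1 : 1 ≤ z := by linarith
  have hlogz : Real.log z = t ^ 2 := by rw [hz, Real.log_exp]
  have ht2 : 0 < t ^ 2 := by positivity
  set L : ℝ := z ^ s with hL
  have hzL : z ≤ L := by
    calc z = z ^ (1 : ℝ) := (Real.rpow_one z).symm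
      _ ≤ z ^ s := Real.rpow_le_rpow_of_exponent_le hz1 hs1
  have hlogL : Real.log L / Real.log z = s := by
    rw [hL, Real.log_rpow hz0, hlogz]; field_simp
  have hL2 : L ^ 2 = Real.exp (2 * s * t ^ 2) := by
    rw [hL, ← Real.rpow_natCast, ← Real.rpow_mul hz0.le, hz, ← Real.exp_mul]
    congr 1; push_cast; ring
  -- the residue classes `r ≡ -x (mod p)`
  set Ω : ℕ → Finset ℕ := fun p => {(p - x % p) % p} with hΩ
  have hΩlt : ∀ p : ℕ, p.Prime → ∀ r ∈ Ω p, r < p := by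
    intro p hp r hr
    rw [hΩ, Finset.mem_singleton] at hr
    rw [hr]; exact Nat.mod_lt _ hp.pos
  have hΩle : ∀ p : ℕ, p.Prime → #(Ω p) ≤ 1 := fun p _ => by rw [hΩ, Finset.card_singleton]
  have hΩp : ∀ p : ℕ, p.Prime → #(Ω p) < p := fun p hp => by
    rw [hΩ, Finset.card_singleton]; exact hp.one_lt
  -- the product is `V`
  have hPB : Nat.primesBelow ⌈z⌉₊ = (Finset.range ⌈z⌉₊).filter Nat.Prime := rfl
  have hprod : ∏ p ∈ Nat.primesBelow ⌈z⌉₊, (1 - (#(Ω p) : ℝ) / p) =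
      ∏ p ∈ (Finset.range ⌈z⌉₊).filter Nat.Prime, (1 - 1 / (p : ℝ)) := by
    rw [hPB]
    refine Finset.prod_congr rfl fun p _ => ?_
    rw [hΩ, Finset.card_singleton, Nat.cast_one]
  set V : ℝ := ∏ p ∈ (Finset.range ⌈z⌉₊).filter Nat.Prime, (1 - 1 / (p : ℝ)) with hV
  have hVc : c / t ^ 4 ≤ V := by
    have h := hVlow Ω hΩle hΩp z hz2
    rw [hprod, hlogz] at h
    have e : (t ^ 2) ^ (2 * 1) = t ^ 4 := by ring
    rwa [e] at h
  have ht4 : 0 < t ^ 4 := by positivity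
  have hV0 : 0 < V := lt_of_lt_of_le (div_pos hc ht4) hVc
  -- the fundamental lemma
  have hmain := hFL x Ω hΩlt hΩle hΩp z L hz2 hzL
  rw [hprod, hlogL, ← card_rough_Ioc_eq x z] at hmain
  -- the sum is `N / V`
  set N : ℕ := #((Ioc x (2 * x)).filter (fun n : ℕ => ∀ p ∈ n.primeFactors, z ≤ (p : ℝ))) with hN
  have hsum : (∑ n ∈ Finset.Ioc x (2 * x),
      (fun n : ℕ => if ∀ p ∈ n.primeFactors, z ≤ (p : ℝ) then 1 / V else 0) n) = (N : ℝ) * (1 / V) := by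
    simp only []
    rw [← Finset.sum_filter, Finset.sum_const, nsmul_eq_mul]
  rw [hsum]
  -- growth: `L² / V ≤ (δ/2) x`
  have hgrowth : Real.exp (2 * s * t ^ 2) * t ^ 4 ≤ δ * c / 2 * x := by
    have h1 : t ^ 4 ≤ Real.exp (4 * t) := by
      have h := Real.add_one_le_exp t
      have h' : t ≤ Real.exp t := by linarith
      calc t ^ 4 ≤ (Real.exp t) ^ 4 := pow_le_pow_left₀ ht0 h' 4
        _ = Real.exp (4 * t) := by rw [← Real.exp_nat_mul]; norm_num
    have h2 := hT t hTt
    have hδc : 0 < δ * c / 2 := by positivity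
    calc Real.exp (2 * s * t ^ 2) * t ^ 4 ≤ Real.exp (2 * s * t ^ 2) * Real.exp (4 * t) :=
          mul_le_mul_of_nonneg_left h1 (Real.exp_pos _).le
      _ = Real.exp (2 * s * t ^ 2 + 4 * t + -Real.log (δ * c / 2) + Real.log (δ * c / 2)) := by
          rw [← Real.exp_add]; ring_nf
      _ ≤ Real.exp (Real.exp t + Real.log (δ * c / 2)) :=
          Real.exp_le_exp.2 (by linarith)
      _ = δ * c / 2 * x := by rw [Real.exp_add, Real.exp_log hδc, hxexp, mul_comm]
  have hL2V : L ^ 2 / V ≤ δ / 2 * x := by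
    rw [hL2, div_le_iff₀ hV0]
    have h1 : Real.exp (2 * s * t ^ 2) ≤ δ * c / 2 * x / t ^ 4 := by
      rw [le_div_iff₀ ht4]; exact hgrowth
    calc Real.exp (2 * s * t ^ 2) ≤ δ * c / 2 * x / t ^ 4 := h1
      _ = δ / 2 * x * (c / t ^ 4) := by ring
      _ ≤ δ / 2 * x * V := mul_le_mul_of_nonneg_left hVc (by positivity)
  -- assemble
  have hkey : (N : ℝ) * (1 / V) - x = ((N : ℝ) - x * V) / V := by field_simp
  rw [hkey, abs_div, abs_of_pos hV0, div_le_iff₀ hV0]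
  calc |(N : ℝ) - x * V| ≤ C * x * V * Real.exp (-s) + L ^ 2 := hmain
    _ = (C * Real.exp (-s)) * x * V + (L ^ 2 / V) * V := by field_simp
    _ ≤ (δ / 2) * x * V + (δ / 2 * x) * V := by
        gcongr
    _ = δ * x * V := by ring

end Summit.Parity.GeneralizedHardyLittlewood.Theorems.ParityLeakOneFifth
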